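import Summits.QuantumFields.YangMills.Theorems.ConvexGribovBodyCovarianceBoundDefs
import Summits.QuantumFields.YangMills.Theorems.ConvexGribovBodyCovarianceBoundDefsB

/-!
# Route `ConvexGribovBody`, crux `CovarianceBound` (stmt-QuantumFields-8780): vocabulary of the line `Sketch`
# (ideator 4, `twist-stiffness-envelope`), part C — twisted Coulomb functionals, the twist gap, the zero-mode pairing

Third vocabulary file of the crux (D-0016 `<Route><Crux>Defs` file; parts A/B are `…CovarianceBoundDefs/DefsB`), for the
skeleton `Cruxes/CovarianceBound/Lines/Sketch.lean` of continuation lead `prover-line-stmt-QuantumFields-8780-c4-0`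
(idea card `Cruxes/CovarianceBound/Ideas/twist-stiffness-envelope.md`, first-lemma file `Cruxes/CovarianceBound/SketchIdeator4.lean`,
whose definitions are transcribed VERBATIM here, same namespace, so that the registered stub signatures do not change).

The line reads the slice Coulomb functional `coulombF r S U ·` as the Hamiltonian of a `G`-valued gauge glass with the
Wilson-distributed time-zero links as quenched disorder, and ties the `p = 0` mode of the minimal-Coulomb-gauge gluon field to
its TWIST (defect) ENERGY:

* `boostedCoulombF r S j U k B` — the slice Coulomb functional of `U^k` with the matrix `B` inserted to the right of `ρ(V_e)` on
  every time-zero link in the spatial direction `j.succ` (a "boost"; for `B = exp(s • X)`, `X ∈ 𝔤`, it is the value of a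
  twisted functional, which is how absolute minimality controls it);
* `twistedCoulombF r S j U h t` — the twist `t ∈ G` inserted on the seam links of direction `j.succ` (base site with
  `x_{j+1} = 2S`): ranging over `(h, t)` this is the Coulomb functional over gauge transformations quasi-periodic in direction
  `j.succ` with jump `t`;
* `perMin` (periodic minimum = the value at any absolute minimiser), `twistMin` (minimum over all twists and gauge
  transformations), `twistGap := perMin − twistMin ≥ 0` — the drop of the minimal slice Coulomb energy when a twisted boundary
  condition is allowed: the defect energy of the Coulomb gauge glass;
* `zeroModePair r S j U h X = −Re tr((Σ_y A_j(y)) X)` — the pairing of the ZERO MODE (`p = 0` cosine mode `Ĉ_j(0) = Σ_y A_j(y)`,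
  `A_j = gluon`) with a generator `X`; for skew-Hermitian `X` it equals `Re tr((Σ_y A_j(y)) Xᴴ) = hsForm (Σ_y A_j(y)) X`, and it is
  `L ×` the first derivative at `s = 0` of `s ↦ boostedCoulombF … (exp (s/L • X))`.

All objects are explicit finite sums or infima of bounded families over nonempty index types (no junk values). Nothing here is
asserted; the only theorem is the registered glue identity `twistedCoulombF_one` (the trivial twist gives back `coulombF`).

References: idea card (above); D. Zwanziger, Nucl. Phys. B 412 (1994) 657, §2 and hep-th/9603203 §5 (horizon function, winding
comparison); J. M. Kosterlitz, N. Akino, cond-mat/9806346 (boundary-condition-optimised defect energies of the 3d gauge glass).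
-/

set_option autoImplicit false

noncomputable section

namespace Summit.QuantumFields.YangMills.Cruxes.CovarianceBound.TwistStiffness

open scoped BigOperators Matrix ComplexConjugate
open MeasureTheory Literature.MathematicalPhysics.QuantumFieldTheory
open Summit.QuantumFields.YangMills.Cruxes.CovarianceBound.SupportWindow

variable {G : Type} [Group G] [TopologicalSpace G]

/-- Boosted slice Coulomb functional: `-Σ_{e slice-spatial} Re tr(ρ((U^k)_e) · [B if e ∥ e_{j+1}, else 1])`. -/
def boostedCoulombF (r : LatticeRep G) (S : ℕ) (j : Fin 3) (U : GaugeConfig 4 (2 * S + 1) G)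
    (k : Site 4 (2 * S + 1) → G) (B : Matrix (Fin r.N) (Fin r.N) ℂ) : ℝ :=
  -∑ e : Edge 4 (2 * S + 1),
    (if e.1 0 = 0 ∧ e.2 ≠ 0 then
      (r.ρ (gaugeTransform k U e) * (if e.2 = j.succ then B else 1)).trace.re else 0)

/-- Twisted slice Coulomb functional: the twist `t` is inserted (to the right, inside `ρ`) on the seam links of direction
`j.succ` — base site with `x_{j+1} = 2S`, i.e. the links wrapping from `2S` to `0`; ranging over `(h, t)` this is the
Coulomb functional over quasi-periodic gauge transformations `h(x + L e_{j+1}) ∼ h(x)·t`. -/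
def twistedCoulombF (r : LatticeRep G) (S : ℕ) (j : Fin 3) (U : GaugeConfig 4 (2 * S + 1) G)
    (h : Site 4 (2 * S + 1) → G) (t : G) : ℝ :=
  -∑ e : Edge 4 (2 * S + 1),
    (if e.1 0 = 0 ∧ e.2 ≠ 0 then
      (r.ρ (gaugeTransform h U e *
        (if e.2 = j.succ ∧ (e.1 j.succ).val = 2 * S then t else 1))).trace.re else 0)

/-- Periodic minimum of the slice Coulomb functional (attained, by compactness: it is `coulombF r S U h` at any
absolute minimiser `h`, `IsCoulMin r S U h`). -/
def perMin (r : LatticeRep G) (S : ℕ) (U : GaugeConfig 4 (2 * S + 1) G) : ℝ :=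
  ⨅ h : Site 4 (2 * S + 1) → G, coulombF r S U h

/-- Minimum of the twisted functional over all twists and all gauge transformations (the best twisted boundary
condition in direction `j.succ`). -/
def twistMin (r : LatticeRep G) (S : ℕ) (j : Fin 3) (U : GaugeConfig 4 (2 * S + 1) G) : ℝ :=
  ⨅ th : G × (Site 4 (2 * S + 1) → G), twistedCoulombF r S j U th.2 th.1

/-- TWIST GAP: how much the minimal slice Coulomb energy drops when a twisted boundary condition in direction `j.succ`
is allowed (`≥ 0`, since `t = 1` is allowed: `twistedCoulombF_one`). The defect energy of the Coulomb gauge glass. -/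
def twistGap (r : LatticeRep G) (S : ℕ) (j : Fin 3) (U : GaugeConfig 4 (2 * S + 1) G) : ℝ :=
  perMin r S U - twistMin r S j U

/-- Zero-mode pairing `−Re tr((Σ_y A_j(y)) X)`, `A_j(y) = gluon r S U h y j` (the anti-Hermitian part of
`ρ((U^h)_{(0,y),j+1})`): for skew-Hermitian `X` it is the `Re tr(· ·ᴴ)`-pairing of the `p = 0` mode `Σ_y A_j(y)` with `X`,
and `(2S+1)⁻¹ ×` it is `d/ds|₀ boostedCoulombF r S j U h (exp (s • X))`. -/
def zeroModePair (r : LatticeRep G) (S : ℕ) (j : Fin 3) (U : GaugeConfig 4 (2 * S + 1) G)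
    (h : Site 4 (2 * S + 1) → G) (X : Matrix (Fin r.N) (Fin r.N) ℂ) : ℝ :=
  -((∑ y : Fin 3 → ZMod (2 * S + 1), gluon r S U h y j) * X).trace.re

/-- Glue identity (registered): the trivial twist gives back the slice Coulomb functional. -/
theorem twistedCoulombF_one (r : LatticeRep G) (S : ℕ) (j : Fin 3) (U : GaugeConfig 4 (2 * S + 1) G)
    (h : Site 4 (2 * S + 1) → G) : twistedCoulombF r S j U h 1 = coulombF r S U h := by
  unfold twistedCoulombF coulombF
  simp only [ite_self, mul_one]

end Summit.QuantumFields.YangMills.Cruxes.CovarianceBound.TwistStiffness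

end
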